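import Summits.BirchSwinnertonDyer.BirchSwinnertonDyer.Theorems.PrintX9MuPartStabilizedOfSpecWitnesses
import Literature.NumberTheory.EllipticCurves.HeegnerStabilizedClassOfCoherentPairProofs
import HarnessLib

/-!
# L∃ FROM A PORT ON CYCLIC DATA: a specialised-witness construction for data `(D, C, X)` carrying the
# `Λ`-adic stabilised class `κ_∞` with EXACT projections `proj_k κ_∞ = δ(κ_k)` and `Λκ_∞(C) = Λ ∙ κ_∞` closes
# the coherent-pair letter (THE CUT v2's shared μ-item of rows 9/10) — proofs file

Cell `pub/bsd-print-x9`, seat `bsd-line-x9-p2` (g2). THEOREMS ONLY; no definition, no named fact, no `sorry`;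
ROUTE-INDEPENDENT (imports no `Theses` file). Namespace of the shared letters
(`Summit.BirchSwinnertonDyer.BirchSwinnertonDyer.Theorems.HeegnerMuPartStabilized`).

WHY. The witness shell `SpecWitnessesCoherentPair` (p632362) hides the engine's pair behind an `∃ C F`; the
principal shell `SpecWitnessesPrincipal` exposes `C`'s principal system `(x, A)` but not the `Λ`-adic class.
The port of Howard's Kolyvagin argument (SKELETON-v9-PLAN, STUB 2) works with the CLASS: `SpecWitness.map_le`
is `f(Λκ_∞(C)) ≤ S_m ∙ κ₁` with `κ₁` the image of the bottom Kolyvagin class, tied to CGLS's `κ_∞ := lim←_k κ_k`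
by Rem. 4.1.4. With the cell's Literature files `HeegnerStabilizedClassExistenceProofs` /
`HeegnerStabilizedModuleCyclicProofs` / `HeegnerStabilizedClassOfCoherentPairProofs` (this seat) the engine's
pair comes WITH `κ_∞ ∈ 𝔖` (`proj_k κ_∞ ∈ stabilizedClassLayer C k` for `k > δ`) and `Λκ_∞(C) = Λ ∙ κ_∞`, so a
port may prove a UNIVERSALLY QUANTIFIED statement over `(D, C, X, κ_∞)` (resp. `(D, C, X, x, A, κ_∞)`) with
these two facts as hypotheses — no `∃`, no engine inside its proof — and still close the letter.

WHAT (the hypotheses are written out as `∀`-statements; no new `def`/`abbrev` is introduced).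
* `specWitnessesCoherentPair_of_forall_cyclic` — «for all data `(D, C, X, z)` under the letters' prefix with
  `proj_k z ∈ stabilizedClassLayer C k` (`k > δ`) and `stabilizedHeegnerModule D C = Λ ∙ z`: `𝔖`, `𝒳` f.g. and
  `𝔖/Λκ_∞(C)` torsion ⟹ `HasSpecWitnesses p 𝔖 𝒳 Λκ_∞(C)`» ⟹ `SpecWitnessesCoherentPair`.
* `specWitnessesCoherentPair_of_forall_principal_cyclic` — the same with the principal system `(x, A)` of `C`
  also in context (binders of `SpecWitnessesPrincipal` + `z`).
* `muPartStabilizedCoherentPair_of_forall_cyclic`, `muPartStabilizedCoherentPair_of_forall_principal_cyclic` —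
  composition with `muPartStabilizedCoherentPair_of_specWitnessesCoherentPair` (p633080): the letter L∃ itself.
HONEST FRAMING: neither hypothesis is proved anywhere (it is the port's deliverable, beyond citable print at
`p ∣ h_K`, REF-118); «beyond-print theorem»: no. BSD is not proved by any of this; no summit statement is
proved by this seat.

References: [CastellaGrossiLeeSkinner2022] Rem. 4.1.4 (arXiv:2008.02571v2 TeX L2278–2294);
[Howard2004HeegnerKolyvagin] §3.3, Thm. 3.3.7, proof of Thm. 2.2.10 (𝔮 = T^m + p).
-/

-- lint justification: the summit-side namespace repeats `BirchSwinnertonDyer` (single-problem summit), as in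
-- every file of `…Theorems.HeegnerMuPartStabilized`; the duplicate-namespace linter would flag every decl.
set_option linter.dupNamespace false
set_option autoImplicit false

noncomputable section

open scoped Classical Pointwise

open Literature Literature.NumberTheory.EllipticCurves WeierstrassCurve

namespace Summit.BirchSwinnertonDyer.BirchSwinnertonDyer.Theorems.HeegnerMuPartStabilized

/-- **L∃-shell from a port on cyclic data.** If for all `(N, W, K, p, κ, γ, jbar)` under the letters' prefix
(`Thm413Hypotheses`, non-CM, (irr), (irr_K), MZ scalars, `p` split, `p ∣ h_K`) and all `(D, C, X, z)` with
`proj_k z ∈ stabilizedClassLayer C k` for every `k > δ` (CGLS's `κ_∞ := lim←_k κ_k`) and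
`stabilizedHeegnerModule D C = Λ ∙ z`, finiteness of `𝔖`, `𝒳` and torsion of `𝔖/Λκ_∞(C)` give
`HasSpecWitnesses p 𝔖 𝒳 Λκ_∞(C)`, then `SpecWitnessesCoherentPair` holds: run the engine WITH its class
(`exists_coherent_pair_envelope_class`). [cite: CastellaGrossiLeeSkinner2022, Rem. 4.1.4 (arXiv:2008.02571v2 TeX L2278–2294)]
[cite: Howard2004HeegnerKolyvagin, Thm. 3.3.7 and proof of Thm. 2.2.10] -/
theorem specWitnessesCoherentPair_of_forall_cyclic
    (h : ∀ (N : ℕ) [NeZero N] (W : WeierstrassCurve ℚ) [W.IsGloballyMinimal] (K : Type) [Field K] [NumberField K]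
      (p : ℕ) [Fact p.Prime] (κ : ZpExtension K p) (γ : Field.absoluteGaloisGroup K)
      (jbar : AlgebraicClosure K →+* ℂ),
      CastellaGrossiLeeSkinner2022.Thm413Hypotheses N W K p κ γ →
      ¬ W.HasCM → W.HasIrreducibleModPGaloisRep p → (W.baseChange K).HasIrreducibleModPGaloisRep p →
      MastellaZerman2026.HasPadicScalarImage W p → SatisfiesHeegnerHypothesis p K →
      p ∣ NumberField.classNumber K →
      ∀ (D : (W.baseChange K).LambdaAdicSelmerData κ γ)
        (C : CastellaGrossiLeeSkinner2022.StabilizedHeegnerData N W K κ jbar)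
        (X : (W.baseChange K).SelmerDualData κ γ) (z : D.S),
      (∀ (k : ℕ) (hk : C.depth < k), D.proj k z ∈ CastellaGrossiLeeSkinner2022.stabilizedClassLayer C k hk) →
      CastellaGrossiLeeSkinner2022.stabilizedHeegnerModule D C = Submodule.span (IwasawaAlgebra p) {z} →
      Module.Finite (IwasawaAlgebra p) D.S → Module.Finite (IwasawaAlgebra p) X.X →
      Module.IsTorsion (IwasawaAlgebra p) (D.S ⧸ CastellaGrossiLeeSkinner2022.stabilizedHeegnerModule D C) →
      HasSpecWitnesses p D.S X.X (CastellaGrossiLeeSkinner2022.stabilizedHeegnerModule D C)) :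
    SpecWitnessesCoherentPair := by
  intro N _ W _ K _ _ p _ κ γ jbar hyp hCM hirr hirrK hsc hHp hhK hpN hTw1 hcardp Dt β hβ D X
  have hlev : N = W.conductorNorm ℤ := hyp.level
  subst hlev
  haveI : W.IsElliptic := hyp.isElliptic
  obtain ⟨C, F, hCDt, hFDt, hCβ, hFβ, hfwd, hrev, z, hz, hcyc⟩ :=
    exists_coherent_pair_envelope_class (W := W) hyp.isImaginaryQuadratic hyp.heegner Dt hβ jbar hyp.ordinary hpN
      κ hyp.topGenerator hTw1 hcardp hyp.noPTorsion D
  exact ⟨C, F, hCDt, hFDt, hCβ, hFβ, hfwd, hrev, fun hfinS hfinX htor ↦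
    h _ W K p κ γ jbar hyp hCM hirr hirrK hsc hHp hhK D C X z hz hcyc hfinS hfinX htor⟩

/-- **L∃-shell from a port on principal cyclic data**: as `specWitnessesCoherentPair_of_forall_cyclic`, with
`C`'s principal system `(x, A)` (the binders of `SpecWitnessesPrincipal`: `complexPoint (x j)` the Heegner point of
conductor `p^j` on `(C.Dt, C.β)`, `x_j` fixed by `Gal(K̄/K[p^j])`, transversals `A_k`, `u_k`/`v_k` the transversal
sums) ALSO in context (`exists_coherent_pair_envelope_principal_class`).
[cite: CastellaGrossiLeeSkinner2022, Thm. 4.1.1 proof and Rem. 4.1.4] [cite: Howard2004HeegnerKolyvagin, §3.3] -/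
theorem specWitnessesCoherentPair_of_forall_principal_cyclic
    (h : ∀ (N : ℕ) [NeZero N] (W : WeierstrassCurve ℚ) [W.IsGloballyMinimal] (K : Type) [Field K] [NumberField K]
      (p : ℕ) [Fact p.Prime] (κ : ZpExtension K p) (γ : Field.absoluteGaloisGroup K)
      (jbar : AlgebraicClosure K →+* ℂ),
      CastellaGrossiLeeSkinner2022.Thm413Hypotheses N W K p κ γ →
      ¬ W.HasCM → W.HasIrreducibleModPGaloisRep p → (W.baseChange K).HasIrreducibleModPGaloisRep p →
      MastellaZerman2026.HasPadicScalarImage W p → SatisfiesHeegnerHypothesis p K →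
      p ∣ NumberField.classNumber K →
      ∀ (D : (W.baseChange K).LambdaAdicSelmerData κ γ)
        (C : CastellaGrossiLeeSkinner2022.StabilizedHeegnerData N W K κ jbar)
        (X : (W.baseChange K).SelmerDualData κ γ)
        (x : ℕ → WeierstrassCurve.geomPoints (W.baseChange K))
        (A : ℕ → Finset (Field.absoluteGaloisGroup K)) (z : D.S),
      (∀ j, complexPoint W jbar (x j) =
        ModularForms.heegnerPointComplexOfConductor C.Dt (NumberField.discr K) C.β (p ^ j)) →
      (∀ j, ∀ σ ∈ ringClassSubgroup K (p ^ j) jbar, σ • x j = x j) →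
      (∀ k, (∀ a ∈ A k, a ∈ κ.layerSubgroup k) ∧
        ∀ τ ∈ κ.layerSubgroup k, ∃! a, a ∈ A k ∧ a⁻¹ * τ ∈ ringClassSubgroup K (p ^ C.d k) jbar) →
      (∀ k, C.u k = ∑ a ∈ A k, a • x (C.d k)) → (∀ k, C.v k = ∑ a ∈ A k, a • x (C.d k - 1)) →
      (∀ (k : ℕ) (hk : C.depth < k), D.proj k z ∈ CastellaGrossiLeeSkinner2022.stabilizedClassLayer C k hk) →
      CastellaGrossiLeeSkinner2022.stabilizedHeegnerModule D C = Submodule.span (IwasawaAlgebra p) {z} →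
      Module.Finite (IwasawaAlgebra p) D.S → Module.Finite (IwasawaAlgebra p) X.X →
      Module.IsTorsion (IwasawaAlgebra p) (D.S ⧸ CastellaGrossiLeeSkinner2022.stabilizedHeegnerModule D C) →
      HasSpecWitnesses p D.S X.X (CastellaGrossiLeeSkinner2022.stabilizedHeegnerModule D C)) :
    SpecWitnessesCoherentPair := by
  intro N _ W _ K _ _ p _ κ γ jbar hyp hCM hirr hirrK hsc hHp hhK hpN hTw1 hcardp Dt β hβ D X
  have hlev : N = W.conductorNorm ℤ := hyp.level
  subst hlev
  haveI : W.IsElliptic := hyp.isElliptic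
  obtain ⟨C, F, x, A, hCDt, hFDt, hCβ, hFβ, hx, hfix, hA, hu, hv, hfwd, hrev, z, hz, hcyc⟩ :=
    exists_coherent_pair_envelope_principal_class (W := W) hyp.isImaginaryQuadratic hyp.heegner Dt hβ jbar
      hyp.ordinary hpN κ hyp.topGenerator hTw1 hcardp hyp.noPTorsion D
  refine ⟨C, F, hCDt, hFDt, hCβ, hFβ, hfwd, hrev, fun hfinS hfinX htor ↦ ?_⟩
  have hx' : ∀ j, complexPoint W jbar (x j) =
      ModularForms.heegnerPointComplexOfConductor C.Dt (NumberField.discr K) C.β (p ^ j) := by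
    intro j
    rw [hCDt, hCβ]
    exact hx j
  exact h _ W K p κ γ jbar hyp hCM hirr hirrK hsc hHp hhK D C X x A z hx' hfix hA hu hv hz hcyc hfinS hfinX htor

/-- **The letter L∃ from a port on cyclic data** (composition with
`muPartStabilizedCoherentPair_of_specWitnessesCoherentPair`). [cite: Howard2004HeegnerKolyvagin, proof of Thm. 2.2.10 (𝔮 = T^m + p)] -/
theorem muPartStabilizedCoherentPair_of_forall_cyclic
    (h : ∀ (N : ℕ) [NeZero N] (W : WeierstrassCurve ℚ) [W.IsGloballyMinimal] (K : Type) [Field K] [NumberField K]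
      (p : ℕ) [Fact p.Prime] (κ : ZpExtension K p) (γ : Field.absoluteGaloisGroup K)
      (jbar : AlgebraicClosure K →+* ℂ),
      CastellaGrossiLeeSkinner2022.Thm413Hypotheses N W K p κ γ →
      ¬ W.HasCM → W.HasIrreducibleModPGaloisRep p → (W.baseChange K).HasIrreducibleModPGaloisRep p →
      MastellaZerman2026.HasPadicScalarImage W p → SatisfiesHeegnerHypothesis p K →
      p ∣ NumberField.classNumber K →
      ∀ (D : (W.baseChange K).LambdaAdicSelmerData κ γ)
        (C : CastellaGrossiLeeSkinner2022.StabilizedHeegnerData N W K κ jbar)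
        (X : (W.baseChange K).SelmerDualData κ γ) (z : D.S),
      (∀ (k : ℕ) (hk : C.depth < k), D.proj k z ∈ CastellaGrossiLeeSkinner2022.stabilizedClassLayer C k hk) →
      CastellaGrossiLeeSkinner2022.stabilizedHeegnerModule D C = Submodule.span (IwasawaAlgebra p) {z} →
      Module.Finite (IwasawaAlgebra p) D.S → Module.Finite (IwasawaAlgebra p) X.X →
      Module.IsTorsion (IwasawaAlgebra p) (D.S ⧸ CastellaGrossiLeeSkinner2022.stabilizedHeegnerModule D C) →
      HasSpecWitnesses p D.S X.X (CastellaGrossiLeeSkinner2022.stabilizedHeegnerModule D C)) :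
    MuPartStabilizedCoherentPair :=
  muPartStabilizedCoherentPair_of_specWitnessesCoherentPair (specWitnessesCoherentPair_of_forall_cyclic h)

end Summit.BirchSwinnertonDyer.BirchSwinnertonDyer.Theorems.HeegnerMuPartStabilized

end
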